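import Summits.CriticalPhenomena.CardyFormulaZ2.Theses.CardySelfDualSegment
import Summits.CriticalPhenomena.CardyFormulaZ2.Theorems.CardyIKTransportAnchorByRigidity
import Literature.Probability.Percolation.CornerPercolation
import Literature.Probability.Percolation.CardyFormulaConformalInvariance
import Literature.Probability.Percolation.SiteConnectionTools
import Literature.Barriers.CriticalPhenomena.EmbeddingModulusUniquenessProofs

/-!
# `QuarterTurnPinning` (stmt-CriticalPhenomena-5475) — endpoint pinning of the self-dual segment

Route `CardySelfDualSegment` of `CriticalPhenomena/CardyFormulaZ2`, crux `QuarterTurnPinning`: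
if `CardyMod 1 α` holds for some `α` in the upper half-plane (the crude crossing probabilities of
the corner model `M_1` converge, in every conformal rectangle `R'`, to Cardy's value of the sheared
rectangle `φ_α R'`), then Bernoulli bond percolation on `ℤ²` at `p = 1/2` satisfies Cardy's formula
for the crude event `embDomainCrossing squareLatticeEmbedding.z` in every conformal rectangle.

SKELETON (line `CardySelfDualSegmentQuarterTurnPinning`, card `phantom-triangular-anchor`):

* `stub_bondCrude_quarterTurn` — the finite-`δ` quarter-turn identity of the crude bond-`ℤ²`
  crossing probability, `P (i R) δ = P R δ` (lattice rotation `(x₀, x₁) ↦ (-x₁, x₀)`,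
  `bondPercolation_real_image`, `Metric.infDist_image`);
* `stub_shearCardy_transfer` — the transfer `C⁺`: for ANY family `P` with quarter-turn invariant
  limits and any non-real `α` such that `P R'` tends to Cardy's value of `φ_α R'`, `P` has Cardy
  limits in every conformal rectangle (the tree's proved `anchorByRigidity_proof` with
  `K := φ_α` as `ℂ ≃L[ℝ] ℂ` and Smirnov's proved theorem as phantom comparison model);
* `QuarterTurnPinning_of` — composition: the route's `let`-blocks are `cornerParam` /
  `cornerConfig` / `cornerCrossingProb` verbatim, and `cornerCrossingProb_eq` +
  `cornerPercolation_one` (`M_1 = P_{1/2}` bond-`ℤ²`) turn `P 1` into the crude bond probability.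

References: V. Beffara, *Is critical 2D percolation universal?* (2008), §2.2 (the order-4 symmetry
pins the modulus); S. Smirnov, C. R. Acad. Sci. Paris 333 (2001).
-/

noncomputable section

open Set Filter Topology Complex MeasureTheory
open UpperHalfPlane (upperHalfPlaneSet)
open Literature.Probability.RandomPlanarGeometry
open Literature.Probability.Percolation hiding cardyFunction
open Literature.Probability.LatticeModels
open Literature.Barriers.CriticalPhenomena

namespace Summit.CriticalPhenomena.CardyFormulaZ2.Theorems

/-- STUB (finite quarter-turn identity): the crude bond-`ℤ²` crossing probability of the
quarter-turned conformal rectangle `i · R` equals that of `R`, for every mesh `δ`. -/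
theorem stub_bondCrude_quarterTurn (R : ConformalRectangle) (δ : ℝ) :
    (bondPercolation (zdGraph 2) half).real
        (embDomainCrossing squareLatticeEmbedding.z
          (R.map (Homeomorph.mulLeft₀ I I_ne_zero)).carrier δ
          ((R.map (Homeomorph.mulLeft₀ I I_ne_zero)).arc 0)
          ((R.map (Homeomorph.mulLeft₀ I I_ne_zero)).arc 2)) =
      (bondPercolation (zdGraph 2) half).real
        (embDomainCrossing squareLatticeEmbedding.z R.carrier δ (R.arc 0) (R.arc 2)) := by
  sorry

/-- STUB (transfer `C⁺`): a family `P` of crossing functions with quarter-turn invariant limits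
whose values on `R'` tend to Cardy's value of the sheared rectangle `φ_α R'` (`α` non-real) has
Cardy limits in every conformal rectangle. Proof: `anchorByRigidity_proof` (item 4969, proved)
with `K := φ_α` packaged as a real-linear automorphism of `ℂ` and Smirnov's theorem
(`hasCrossingLimit_triDomainCrossingProb_holds`) as the comparison model; hypothesis (b) of that
theorem holds because both families converge to the same Cardy value (uniqueness of limits). -/
theorem stub_shearCardy_transfer (P : ConformalRectangle → ℝ → ℝ)
    (hqt : ∀ (R : ConformalRectangle) (L : ℝ),
      Tendsto (P (R.map (Homeomorph.mulLeft₀ I I_ne_zero))) (𝓝[>] 0) (𝓝 L) ↔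
        Tendsto (P R) (𝓝[>] 0) (𝓝 L))
    {α : ℂ} (hα : α.im ≠ 0)
    (hC : ∀ (R R' : ConformalRectangle) (φ : ConformalEquiv upperHalfPlaneSet R.carrier)
      (x : Fin 4 → ℝ), R.carrier = moduliShear α '' R'.carrier →
      (∀ i, R.pt i = moduliShear α (R'.pt i)) → R.IsUniformizing φ x →
      Tendsto (P R') (𝓝[>] 0) (𝓝 (cardyFunction (crossRatio x)))) :
    ∀ R : ConformalRectangle, R.HasCrossingLimit (P R) cardyFunction := by
  -- `K := φ_α` as a continuous real-linear automorphism of `ℂ`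
  obtain ⟨K, hK⟩ : ∃ K : ℂ ≃L[ℝ] ℂ, ⇑K.toHomeomorph = moduliShear α :=
    ⟨{ toFun := moduliShear α
       invFun := (shearHomeomorph α hα).symm
       map_add' := fun z w => by
         simp only [moduliShear, add_re, add_im, ofReal_add]; ring
       map_smul' := fun r z => by
         simp only [moduliShear, RingHom.id_apply, Complex.real_smul, re_ofReal_mul,
           im_ofReal_mul, ofReal_mul]; ring
       left_inv := (shearHomeomorph α hα).left_inv
       right_inv := (shearHomeomorph α hα).right_inv
       continuous_toFun := continuous_moduliShear α
       continuous_invFun := (shearHomeomorph α hα).symm.continuous }, rfl⟩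
  refine (anchorByRigidity_proof hasCrossingLimit_triDomainCrossingProb_holds P K hqt ?_).2
  intro R L
  obtain ⟨φ, x, hφ⟩ := MarkedDomain.exists_isUniformizing_holds (R.map K.toHomeomorph)
  have t1 : Tendsto (P R) (𝓝[>] 0) (𝓝 (cardyFunction (crossRatio x))) :=
    hC (R.map K.toHomeomorph) R φ x (by rw [MarkedDomain.carrier_map, hK])
      (fun i => by rw [MarkedDomain.pt_map, hK]) hφ
  have t2 : Tendsto (triDomainCrossingProb (R.map K.toHomeomorph)) (𝓝[>] 0)
      (𝓝 (cardyFunction (crossRatio x))) :=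
    hasCrossingLimit_triDomainCrossingProb_holds (R.map K.toHomeomorph) φ x hφ
  constructor
  · intro h
    rw [tendsto_nhds_unique h t1]
    exact t2
  · intro h
    rw [tendsto_nhds_unique h t2]
    exact t1

/-- COMPOSITION: the two stubs imply the crux `QuarterTurnPinning`. The route's inlined
`let`-blocks are definitionally `cornerParam` / `cornerConfig` / `cornerCrossingProb`; at `t = 1`
the corner model is Bernoulli bond percolation at `1/2` (`cornerPercolation_one`), so `P 1 R'` is
the crude bond crossing probability, to which `stub_shearCardy_transfer` applies with the
quarter-turn identity `stub_bondCrude_quarterTurn`. -/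
theorem QuarterTurnPinning_of :
    Summit.CriticalPhenomena.CardyFormulaZ2.Theses.CardySelfDualSegment.QuarterTurnPinning := by
  unfold Summit.CriticalPhenomena.CardyFormulaZ2.Theses.CardySelfDualSegment.QuarterTurnPinning
  intro prm cfg P CardyMod hex
  obtain ⟨α, hα, hCM⟩ := hex
  have hP1 : ∀ R' : ConformalRectangle, P 1 R' = fun δ => (bondPercolation (zdGraph 2) half).real
      (embDomainCrossing squareLatticeEmbedding.z R'.carrier δ (R'.arc 0) (R'.arc 2)) := by
    intro R'
    funext δ
    show cornerCrossingProb 1 R' δ = _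
    rw [cornerCrossingProb_eq, cornerPercolation_one]
  exact stub_shearCardy_transfer
    (fun R δ => (bondPercolation (zdGraph 2) half).real
      (embDomainCrossing squareLatticeEmbedding.z R.carrier δ (R.arc 0) (R.arc 2)))
    (fun R L => by simp only [stub_bondCrude_quarterTurn])
    hα.ne'
    (fun R R' φ x hc hp hu => by
      have h := hCM R R' φ x hc hp hu
      rw [hP1 R'] at h
      exact h)

end Summit.CriticalPhenomena.CardyFormulaZ2.Theorems

end
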